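import Literature.Geometry.Lorentzian.LeviCivitaCurvature
import Literature.Geometry.Lorentzian.Basic
import HarnessLib

/-!
# Crux `HawkingExtensionIsKerr` (stmt-FinalStateConjecture-17840), line `SketchIdeator2` —
# programme NH (near-horizon sign analysis): curvature algebra in adapted frames

Registered sub-goal `stub_nh_curvatureAlgebra` of the line lead's skeleton: two pointwise
curvature identities obtained by expanding traces in a frame adapted to the metric.

* **NH3 (`sec P = sec P^⊥` on a Ricci-flat 4-manifold, null frame).** At a point `p` of a
  `4`-manifold with `Ric_p = 0`, for a frame `{K, N, e₁, e₂}` of `T_pM` with `K, N` null,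
  `ε := g(K,N) ≠ 0`, `e₁, e₂` orthonormal and orthogonal to `K, N`:
  `g(R(N,K)N, K) = ε² g(R(e₂,e₁)e₁, e₂)`.  PROOF: `{K, N, e₁, e₂}` is a basis with dual
  functionals `g(·, N)/ε`, `g(·, K)/ε`, `g(·, eᵢ)`, so `tr L = [g(LK,N) + g(LN,K)]/ε + Σ g(Leᵢ,eᵢ)`
  for every endomorphism `L`; applied to `L = R(·,X)Y` (whose trace is `Ric(X,Y)`, Lee (7.24))
  with `(X,Y) = (K,N), (e₁,e₁), (e₂,e₂)` and the curvature symmetries (O'Neill 1983, Prop. 3.36)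
  the three vacuum equations read `C/ε + A₁ + A₂ = 0`, `2Aᵢ/ε + B = 0` with
  `C = Rm(N,K,N,K)`, `Aᵢ = Rm(N,eᵢ,eᵢ,K)`, `B = Rm(e₂,e₁,e₁,e₂)`, whence `C = ε² B`.
* **NH6 (`S = 2K` on a surface).** At a point `s` of a `2`-manifold, for an orthonormal frame
  `{e₁, e₂}`: `S(s) = tr_γ Ric = Ric(e₁,e₁) + Ric(e₂,e₂) = 2 Rm(e₂,e₁,e₁,e₂)`.

Both are proved for an arbitrary model `I` on a finite-dimensional `E` (`finrank ℝ E = 4`,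
resp. `= 2`) and then assembled into the registered closed form over `E4`- and
`EuclideanSpace ℝ (Fin 2)`-charted manifolds.  Ingredients: `LinearMap.trace_eq_matrix_trace`,
`basisOfLinearIndependentOfCardEqFinrank` (Mathlib); `IsLeviCivita.val_curvature_pair_symm`,
`PseudoRiemannianMetric.val_riemann_skew`, `CovariantDerivative.curvature_antisymm/curvature_self`
(tree, `LeviCivitaCurvature.lean`, `LeviCivitaProofs.lean`, `Curvature.lean`).
-/

noncomputable section

set_option linter.dupNamespace false

namespace Summit.FinalStateConjecture.FinalStateConjecture.Theorems.HawkingExtensionIsKerr.SketchIdeator2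

open Set Function Literature.Geometry.Lorentzian
open scoped Manifold ContDiff Topology

/-! ### Linear algebra: the trace in a basis with a dual family of functionals -/

/-- **Trace in a basis with dual functionals**: if `φ i (b j) = δᵢⱼ` for a basis `b`, then
`tr L = Σᵢ φᵢ (L bᵢ)` (the `φᵢ` are the coordinate functionals of `b`). -/
theorem trace_eq_sum_dual {ι V : Type*} [Fintype ι] [DecidableEq ι] [AddCommGroup V]
    [Module ℝ V] (b : Module.Basis ι ℝ V) (φ : ι → V →ₗ[ℝ] ℝ)
    (hφ : ∀ i j, φ i (b j) = if j = i then 1 else 0) (L : V →ₗ[ℝ] V) :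
    LinearMap.trace ℝ V L = ∑ i, φ i (L (b i)) := by
  rw [LinearMap.trace_eq_matrix_trace ℝ b, Matrix.trace]
  refine Finset.sum_congr rfl fun i _ ↦ ?_
  rw [Matrix.diag_apply, LinearMap.toMatrix_apply]
  have hcoord : b.coord i = φ i := by
    refine b.ext fun j ↦ ?_
    rw [Module.Basis.coord_apply, b.repr_self, Finsupp.single_apply, hφ]
  rw [← hcoord, Module.Basis.coord_apply]

/-! ### Traces on a tangent space in a `g`-dual pair of frames -/

section Frames

variable {E : Type*} [NormedAddCommGroup E] [NormedSpace ℝ E]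
  {H : Type*} [TopologicalSpace H] {I : ModelWithCorners ℝ E H}
  {M : Type*} [TopologicalSpace M] [ChartedSpace H M] [IsManifold I ∞ M]
  {g : PseudoRiemannianMetric I ∞ E (TangentSpace I : M → Type _)}
  {ι : Type*} [Fintype ι] [DecidableEq ι] [Nonempty ι] {p : M} {v w : ι → TangentSpace I p}

/-- **Trace in a `g`-dual pair of frames.** If `g(wᵢ, vⱼ) = δᵢⱼ` for families `v, w` of
`finrank` many tangent vectors at `p`, then `v` is a basis with coordinate functionals
`g(wᵢ, ·)`, so `tr L = Σᵢ g(wᵢ, L vᵢ)` for every endomorphism `L` of `T_pM`. -/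
theorem trace_eq_sum_val_of_dualFrame
    (hvw : ∀ i j, g.val p (w i) (v j) = if j = i then 1 else 0)
    (hcard : Fintype.card ι = Module.finrank ℝ E)
    (L : TangentSpace I p →ₗ[ℝ] TangentSpace I p) :
    LinearMap.trace ℝ (TangentSpace I p) L = ∑ i, g.val p (w i) (L (v i)) := by
  have hli : LinearIndependent ℝ v := by
    rw [Fintype.linearIndependent_iff]
    intro c hc i
    have h := congrArg (g.val p (w i)) hc
    simpa [map_sum, map_smul, hvw] using h
  have hcard' : Fintype.card ι = Module.finrank ℝ (TangentSpace I p) := hcard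
  set b := basisOfLinearIndependentOfCardEqFinrank hli hcard'
  have hb : ∀ i, b i = v i := fun i ↦
    congrFun (coe_basisOfLinearIndependentOfCardEqFinrank hli hcard') i
  rw [trace_eq_sum_dual b (fun i ↦ (g.val p (w i) : TangentSpace I p →ₗ[ℝ] ℝ))
    (fun i j ↦ by simpa [hb] using hvw i j) L]
  simp only [ContinuousLinearMap.coe_coe, hb]

/-- **Metric trace in a `g`-dual pair of frames**: `tr_g T = Σᵢ T(vᵢ, wᵢ)`
(`g.trace p T = tr (♯ ∘ T)` and `g(wᵢ, ♯(T vᵢ)) = T(vᵢ, wᵢ)`). -/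
theorem metricTrace_eq_sum_of_dualFrame [FiniteDimensional ℝ E]
    (hvw : ∀ i j, g.val p (w i) (v j) = if j = i then 1 else 0)
    (hcard : Fintype.card ι = Module.finrank ℝ E)
    (T : LinearMap.BilinForm ℝ (TangentSpace I p)) :
    g.trace p T = ∑ i, T (v i) (w i) := by
  rw [PseudoRiemannianMetric.trace, trace_eq_sum_val_of_dualFrame hvw hcard]
  refine Finset.sum_congr rfl fun i _ ↦ ?_
  rw [LinearMap.comp_apply, LinearEquiv.coe_coe, g.symm, PseudoRiemannianMetric.val_sharp_apply]

/-- **The Ricci tensor in a `g`-dual pair of frames**: `Ric(X,Y) = Σᵢ g(wᵢ, R(vᵢ,X)Y)`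
(`Ric(X,Y) = tr (v ↦ R(v,X)Y)`, Lee, *Riemannian Manifolds*, (7.24)). -/
theorem ricci_eq_sum_of_dualFrame [g.HasLeviCivita]
    (hvw : ∀ i j, g.val p (w i) (v j) = if j = i then 1 else 0)
    (hcard : Fintype.card ι = Module.finrank ℝ E) (X Y : TangentSpace I p) :
    g.ricci p X Y = ∑ i, g.val p (w i) (g.riemann p (v i) X Y) := by
  rw [PseudoRiemannianMetric.ricci_apply, CovariantDerivative.ricci_apply,
    trace_eq_sum_val_of_dualFrame hvw hcard]
  rfl

end Frames

/-! ### Curvature symmetries, restated for `g.riemann` -/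

section Curvature

variable {E : Type*} [NormedAddCommGroup E] [NormedSpace ℝ E] [FiniteDimensional ℝ E]
  [CompleteSpace E] {H : Type*} [TopologicalSpace H] {I : ModelWithCorners ℝ E H}
  {M : Type*} [TopologicalSpace M] [ChartedSpace H M] [IsManifold I ∞ M]
  {g : PseudoRiemannianMetric I ∞ E (TangentSpace I : M → Type _)} [g.HasLeviCivita]

omit [FiniteDimensional ℝ E] [CompleteSpace E] in
/-- `R(X,X)Z = 0` (O'Neill 1983, Prop. 3.36 (1)). -/
theorem riemann_self (p : M) (X Z : TangentSpace I p) : g.riemann p X X Z = 0 :=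
  g.leviCivita.curvature_self X Z

omit [FiniteDimensional ℝ E] [CompleteSpace E] in
/-- Antisymmetry `R(X,Y)Z = -R(Y,X)Z` (O'Neill 1983, Prop. 3.36 (1)). -/
theorem riemann_antisymm (p : M) (X Y Z : TangentSpace I p) :
    g.riemann p X Y Z = -g.riemann p Y X Z :=
  g.leviCivita.curvature_antisymm X Y Z

/-- Pair symmetry `g(R(X,Y)Z, W) = g(R(Z,W)X, Y)` (O'Neill 1983, Prop. 3.36 (4);
`IsLeviCivita.val_curvature_pair_symm` for `g.leviCivita`, restated for `g.riemann`). -/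
theorem val_riemann_pair_symm (p : M) (X Y Z W : TangentSpace I p) :
    g.val p (g.riemann p X Y Z) W = g.val p (g.riemann p Z W X) Y :=
  (PseudoRiemannianMetric.isLeviCivita_leviCivita_holds (g := g)).val_curvature_pair_symm
    (WithTop.coe_le_coe.mpr le_top) p X Y Z W

/-! ### NH3: the null-frame identity on a Ricci-flat `4`-manifold -/

/-- **NH3 (`sec P = sec P^⊥` in vacuum, null frame).** On a `4`-manifold, at a point `p` with
`Ric_p = 0`, for null `K, N` with `g(K,N) ≠ 0` and orthonormal `e₁, e₂ ⊥ K, N`: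
`g(R(N,K)N, K) = g(K,N)² · g(R(e₂,e₁)e₁, e₂)`.  The traces `Ric(K,N)`, `Ric(e₁,e₁)`,
`Ric(e₂,e₂)` in the frame `{K, N, e₁, e₂}` (dual frame `{N/ε, K/ε, e₁, e₂}`) and the curvature
symmetries. -/
theorem val_riemann_nullFrame_of_ricci_eq_zero (h4 : Module.finrank ℝ E = 4) {p : M}
    {K N e₁ e₂ : TangentSpace I p} (hRic : g.ricci p = 0) (hKK : g.val p K K = 0)
    (hNN : g.val p N N = 0) (hKN : g.val p K N ≠ 0) (h11 : g.val p e₁ e₁ = 1)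
    (h22 : g.val p e₂ e₂ = 1) (h12 : g.val p e₁ e₂ = 0) (hK1 : g.val p K e₁ = 0)
    (hK2 : g.val p K e₂ = 0) (hN1 : g.val p N e₁ = 0) (hN2 : g.val p N e₂ = 0) :
    g.val p (g.riemann p N K N) K = (g.val p K N) ^ 2 * g.val p (g.riemann p e₂ e₁ e₁) e₂ := by
  have h2 : (2 : ℕ∞ω) ≤ ∞ := WithTop.coe_le_coe.mpr le_top
  set ε := g.val p K N
  have hKNε : g.val p K N = ε := rfl
  have hNK : g.val p N K = ε := by rw [g.symm]
  have h21 : g.val p e₂ e₁ = 0 := by rw [g.symm, h12]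
  have h1K : g.val p e₁ K = 0 := by rw [g.symm, hK1]
  have h2K : g.val p e₂ K = 0 := by rw [g.symm, hK2]
  have h1N : g.val p e₁ N = 0 := by rw [g.symm, hN1]
  have h2N : g.val p e₂ N = 0 := by rw [g.symm, hN2]
  -- the frame and its `g`-dual frame
  set v : Fin 4 → TangentSpace I p := ![K, N, e₁, e₂] with hv
  set w : Fin 4 → TangentSpace I p := ![ε⁻¹ • N, ε⁻¹ • K, e₁, e₂] with hw
  have hvw : ∀ i j, g.val p (w i) (v j) = if j = i then 1 else 0 := by
    intro i j
    fin_cases i <;> fin_cases j <;>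
      simp [hv, hw, hKK, hNN, hKNε, hNK, h11, h22, h12, h21, hK1, hK2, hN1, hN2, h1K, h2K, h1N,
        h2N, hKN]
  have hcard : Fintype.card (Fin 4) = Module.finrank ℝ E := by rw [Fintype.card_fin, h4]
  have hRicci : ∀ X Y, g.ricci p X Y =
      ε⁻¹ * g.val p N (g.riemann p K X Y) + ε⁻¹ * g.val p K (g.riemann p N X Y) +
        g.val p e₁ (g.riemann p e₁ X Y) + g.val p e₂ (g.riemann p e₂ X Y) := by
    intro X Y
    rw [ricci_eq_sum_of_dualFrame hvw hcard, Fin.sum_univ_four]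
    simp [hv, hw]
  have eq1 := hRicci K N
  have eq2 := hRicci e₁ e₁
  have eq3 := hRicci e₂ e₂
  rw [hRic, LinearMap.zero_apply, LinearMap.zero_apply] at eq1 eq2 eq3
  -- rewrite every curvature component through `C, A₁, A₂, B`
  rw [riemann_self, map_zero, g.symm p K (g.riemann p N K N),
    g.symm p e₁ (g.riemann p e₁ K N), g.symm p e₂ (g.riemann p e₂ K N),
    val_riemann_pair_symm p e₁ K N e₁, val_riemann_pair_symm p e₂ K N e₂] at eq1
  rw [riemann_self, map_zero, g.symm p N (g.riemann p K e₁ e₁),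
    g.symm p K (g.riemann p N e₁ e₁), g.symm p e₂ (g.riemann p e₂ e₁ e₁),
    val_riemann_pair_symm p K e₁ e₁ N, riemann_antisymm p e₁ N K, map_neg,
    _root_.neg_apply, g.val_riemann_skew h2 p N e₁ K e₁, neg_neg] at eq2
  rw [riemann_self, map_zero, g.symm p N (g.riemann p K e₂ e₂),
    g.symm p K (g.riemann p N e₂ e₂), g.symm p e₁ (g.riemann p e₁ e₂ e₂),
    val_riemann_pair_symm p K e₂ e₂ N, riemann_antisymm p e₂ N K, map_neg,
    _root_.neg_apply, g.val_riemann_skew h2 p N e₂ K e₂, neg_neg,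
    val_riemann_pair_symm p e₁ e₂ e₂ e₁] at eq3
  -- the linear algebra
  set C := g.val p (g.riemann p N K N) K
  set A₁ := g.val p (g.riemann p N e₁ e₁) K
  set A₂ := g.val p (g.riemann p N e₂ e₂) K
  set B := g.val p (g.riemann p e₂ e₁ e₁) e₂
  have eq1' : C + ε * A₁ + ε * A₂ = 0 := by
    have := congrArg (fun t ↦ ε * t) eq1
    simp only [mul_add, mul_zero, ← mul_assoc, mul_inv_cancel₀ hKN, one_mul] at this
    linear_combination -this
  have eq2' : 2 * A₁ + ε * B = 0 := by
    have := congrArg (fun t ↦ ε * t) eq2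
    simp only [mul_add, mul_zero, ← mul_assoc, mul_inv_cancel₀ hKN, one_mul] at this
    linear_combination -this
  have eq3' : 2 * A₂ + ε * B = 0 := by
    have := congrArg (fun t ↦ ε * t) eq3
    simp only [mul_add, mul_zero, ← mul_assoc, mul_inv_cancel₀ hKN, one_mul] at this
    linear_combination -this
  linear_combination eq1' - (ε / 2) * eq2' - (ε / 2) * eq3'

/-! ### NH6: the scalar curvature of a surface in an orthonormal frame -/

/-- **NH6 (`S = 2K` in dimension two).** On a `2`-manifold, for an orthonormal frame `{e₁, e₂}`
at `p`: `S(p) = tr_γ Ric = Ric(e₁,e₁) + Ric(e₂,e₂) = 2 g(R(e₂,e₁)e₁, e₂)` (O'Neill 1983, Ch. 3,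
Def. 3.53 with Lemma 3.52 and Prop. 3.36 (4)). -/
theorem scalarCurvature_eq_two_mul_of_orthonormal (h2 : Module.finrank ℝ E = 2) {p : M}
    {e₁ e₂ : TangentSpace I p} (h11 : g.val p e₁ e₁ = 1) (h22 : g.val p e₂ e₂ = 1)
    (h12 : g.val p e₁ e₂ = 0) :
    g.scalarCurvature p = 2 * g.val p (g.riemann p e₂ e₁ e₁) e₂ := by
  have h21 : g.val p e₂ e₁ = 0 := by rw [g.symm, h12]
  set v : Fin 2 → TangentSpace I p := ![e₁, e₂] with hv
  have hvv : ∀ i j, g.val p (v i) (v j) = if j = i then 1 else 0 := by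
    intro i j
    fin_cases i <;> fin_cases j <;> simp [hv, h11, h22, h12, h21]
  have hcard : Fintype.card (Fin 2) = Module.finrank ℝ E := by rw [Fintype.card_fin, h2]
  rw [PseudoRiemannianMetric.scalarCurvature, metricTrace_eq_sum_of_dualFrame hvv hcard,
    Fin.sum_univ_two, ricci_eq_sum_of_dualFrame hvv hcard, ricci_eq_sum_of_dualFrame hvv hcard,
    Fin.sum_univ_two, Fin.sum_univ_two]
  simp only [hv, Matrix.cons_val_zero, Matrix.cons_val_one]
  rw [riemann_self, riemann_self, map_zero, map_zero, g.symm p e₂ (g.riemann p e₂ e₁ e₁),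
    g.symm p e₁ (g.riemann p e₁ e₂ e₂), val_riemann_pair_symm p e₁ e₂ e₂ e₁]
  ring

end Curvature

/-! ### The registered closed form -/

/-- **Registered sub-goal `stub_nh_curvatureAlgebra`** (crux stmt-FinalStateConjecture-17840,
line `SketchIdeator2`, programme NH): NH3 (`g(R(N,K)N,K) = g(K,N)² g(R(e₂,e₁)e₁,e₂)` in a null
frame at a Ricci-flat point of an `E4`-charted manifold) ∧ NH6 (`S = 2 g(R(e₂,e₁)e₁,e₂)` in an
orthonormal frame of a surface). -/
theorem stub_nh_curvatureAlgebra : (∀ (M : Type) [TopologicalSpace M] [ChartedSpace E4 M] [IsManifold (𝓡 4) ∞ M] (g : PseudoRiemannianMetric (𝓡 4) ∞ E4 (TangentSpace (𝓡 4) : M → Type _)) [g.HasLeviCivita] (p : M) (K N e₁ e₂ : TangentSpace (𝓡 4) p), g.ricci p = 0 → g.val p K K = 0 → g.val p N N = 0 → g.val p K N ≠ 0 → g.val p e₁ e₁ = 1 → g.val p e₂ e₂ = 1 → g.val p e₁ e₂ = 0 → g.val p K e₁ = 0 → g.val p K e₂ = 0 → g.val p N e₁ = 0 → g.val p N e₂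 = 0 → g.val p (g.riemann p N K N) K = (g.val p K N) ^ 2 * g.val p (g.riemann p e₂ e₁ e₁) e₂) ∧ (∀ (S : Type) [TopologicalSpace S] [ChartedSpace (EuclideanSpace ℝ (Fin 2)) S] [IsManifold (𝓡 2) ∞ S] (γ : PseudoRiemannianMetric (𝓡 2) ∞ (EuclideanSpace ℝ (Fin 2)) (TangentSpace (𝓡 2) : S → Type _)) [γ.HasLeviCivita] (s : S) (e₁ e₂ : TangentSpace (𝓡 2) s), γ.val s e₁ e₁ = 1 → γ.val s e₂ e₂ = 1 → γ.val s e₁ e₂ = 0 → γ.scalarCurvature s = 2 * γ.val s (γ.riemann s e₂ e₁ e₁) e₂) :=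
  ⟨fun _ _ _ _ _ _ _ _ _ _ _ hRic hKK hNN hKN h11 h22 h12 hK1 hK2 hN1 hN2 ↦
      val_riemann_nullFrame_of_ricci_eq_zero finrank_euclideanSpace_fin hRic hKK hNN hKN h11 h22
        h12 hK1 hK2 hN1 hN2,
    fun _ _ _ _ _ _ _ _ _ h11 h22 h12 ↦
      scalarCurvature_eq_two_mul_of_orthonormal finrank_euclideanSpace_fin h11 h22 h12⟩

end Summit.FinalStateConjecture.FinalStateConjecture.Theorems.HawkingExtensionIsKerr.SketchIdeator2

end
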